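import Summits.HubbardSuperconductivity.HubbardSuperconductivity.Theorems.AnisotropyChordTransferFibre3RowDecomposition
import Summits.HubbardSuperconductivity.HubbardSuperconductivity.Theorems.AnisotropyChordTransferFibre3GreenZero

/-!
# Route `AnisotropyChord` / H0 rotor rung: PartN39 — the λ-part RESOLVENT IDENTITY, the centred phase, and the λ-half RATE bound, PROVED

PORT PartN39 (`…Fibre3RateLemma`, theory seat `hubbard-h0-rotor-theory-1` g21, memo 21 §320) types
* `LamPartIdentity` — `δ_λ(r) := a_L(r;λ) − a_L(r;0) = (λ/V) Σ_{k≠0} (1 − Re e^{ik·r})/(2ε(k)(2ε(k) − λ))` (`0 ≤ λ < 2ε₁`);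
* `PhaseReCentred` — `Re e^{ik·r} = cos((k·r)_c)` with the centred angle `(k·r)_c = 2π·valMinAbs(k₁r₁ + k₂r₂)/L`;
* `LamPartShellBound` — `0 ≤ δ_λ(r) ≤ S(r,L;λ)` (termwise `1 − cos x ≤ min 2 (x²/2)`, `termwise_shell`).
This file proves all three (`lamPartIdentity_holds`, `phaseReCentred_holds`, `lamPartShellBound_holds`).  Together with
`shellMajorant_holds` (`…Fibre3ShellMajorant`) this is the λ-half of the RATE lemma of the HOLE₂(.75) near-pair tail with
explicit constants: `0 ≤ δ_λ(r) ≤ S(r,L;λ) ≤ |r|²(11.71 ln L + 5.9)/L²`.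
Prover seat `hubbard-h0-rotor-p2` g0; helper for stmt-HubbardSuperconductivity-19089 (`--supports`, helper class).
WHAT THIS IS NOT: nothing here proves superconductivity in the Hubbard model; helper lemmas of ONE conditional reduction
(rung 19089, HOLE₂(.75) near-pair tail).  Mathlib + tree imports only; no sorry, no axioms.
-/

set_option linter.dupNamespace false

noncomputable section

namespace Summit.HubbardSuperconductivity.HubbardSuperconductivity.Theorems.AnisotropyChord.Transfer.Fibre3

namespace RateLemma

open Real Finset

variable (L : ℕ) [NeZero L]

omit [NeZero L] in
/-- `ε₁ > 0` for `L ≥ 2`. -/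
theorem eps1_pos_of_two_le (hL : 2 ≤ L) : 0 < eps1 L := by
  have h := cos_ne_one L 1 one_pos (by omega)
  have h' : Real.cos (2 * Real.pi / L) ≠ 1 := by simpa using h
  have hle := Real.cos_le_one (2 * Real.pi / L)
  unfold eps1
  have : Real.cos (2 * Real.pi / L) < 1 := lt_of_le_of_ne hle h'
  linarith

omit [NeZero L] in
/-- `Re e^{ik·0} = 1`. -/
theorem phase_zero_re (k : Tor L) : (phase L k 0).re = 1 := by
  rw [phase_re]
  simp

/-- the resolvent difference termwise: `g_λ(k) − g_0(k) = λ/(2ε(2ε − λ))` off `k = 0` (and `0` at `k = 0`). -/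
theorem gres_sub_gres_zero (lam2 : ℝ) (hlam : lam2 < 2 * eps1 L) (k : Tor L) :
    gres L lam2 k - gres L 0 k
      = if k = 0 then 0 else lam2 / ((2 * epsT L k) * (2 * epsT L k - lam2)) := by
  unfold gres
  by_cases hk : k = 0
  · simp [hk]
  · rw [if_neg hk, if_neg hk, if_neg hk, sub_zero]
    have hL : 2 ≤ L := by
      by_contra h
      have hL1 : L = 1 := by have := NeZero.ne L; omega
      apply hk
      subst hL1
      exact Subsingleton.elim _ _
    have hε : eps1 L ≤ epsT L k := eps1_le_epsT L hL hk
    have hε₁ := eps1_pos_of_two_le L hL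
    have ha : (2 * epsT L k) ≠ 0 := by linarith
    have hal : 2 * epsT L k - lam2 ≠ 0 := by linarith
    exact one_div_sub_one_div_eq _ _ ha hal

/-- ★ `LamPartIdentity` holds. -/
theorem lamPartIdentity_holds : LamPartIdentity L := by
  intro lam2 _h0 hlam r
  unfold lamPart lamPartSum aKer Gres
  have hV : ((L : ℝ) ^ 2) ≠ 0 := by
    have : (L : ℝ) ≠ 0 := by exact_mod_cast NeZero.ne L
    positivity
  rw [← sub_div, ← sub_div, ← sub_div, ← Finset.sum_sub_distrib, ← Finset.sum_sub_distrib, ← Finset.sum_sub_distrib,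
    Finset.mul_sum]
  congr 1
  refine Finset.sum_congr rfl (fun k _ => ?_)
  have h := gres_sub_gres_zero L lam2 hlam k
  rw [phase_zero_re]
  by_cases hk : k = 0
  · subst hk
    simp [gres]
  · rw [if_neg hk] at h
    rw [if_neg hk]
    have e : gres L lam2 k * 1 - gres L lam2 k * (phase L k r).re - (gres L 0 k * 1 - gres L 0 k * (phase L k r).re)
        = (gres L lam2 k - gres L 0 k) * (1 - (phase L k r).re) := by ring
    rw [e, h]
    ring

/-- ★ `PhaseReCentred` holds: `Re e^{ik·r} = cos((k·r)_c)`. -/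
theorem phaseReCentred_holds : PhaseReCentred L := by
  intro k r
  rw [phase_re]
  unfold kdotC
  set n : ℕ := k.1.val * r.1.val + k.2.val * r.2.val with hn
  set z : ZMod L := k.1 * r.1 + k.2 * r.2 with hz
  have hzn : (z : ZMod L) = ((n : ℤ) : ZMod L) := by
    rw [hz, hn]
    push_cast
    simp
  have hv : ((z.valMinAbs : ℤ) : ZMod L) = ((n : ℤ) : ZMod L) := by rw [ZMod.coe_valMinAbs, hzn]
  rw [ZMod.intCast_eq_intCast_iff_dvd_sub] at hv
  obtain ⟨m, hm⟩ := hv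
  have hL : (L : ℝ) ≠ 0 := by exact_mod_cast NeZero.ne L
  have e : 2 * Real.pi * ((z.valMinAbs : ℤ) : ℝ) / L = 2 * Real.pi * (n : ℝ) / L + ((-m : ℤ) : ℝ) * (2 * Real.pi) := by
    have hm' : ((n : ℤ) : ℝ) - ((z.valMinAbs : ℤ) : ℝ) = (L : ℝ) * (m : ℝ) := by exact_mod_cast hm
    push_cast at hm' ⊢
    field_simp
    linarith [hm']
  rw [e, Real.cos_add_int_mul_two_pi]

/-- ★ `LamPartShellBound` holds: `0 ≤ δ_λ(r) ≤ S(r,L;λ)`. -/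
theorem lamPartShellBound_holds : LamPartShellBound L := by
  intro hL lam2 h0 hlam r
  rw [lamPartIdentity_holds L lam2 h0 hlam r]
  unfold lamPartSum shellSum
  have hL2 : 2 ≤ L := by omega
  have hV : (0 : ℝ) < (L : ℝ) ^ 2 := by
    have : (0 : ℝ) < L := by exact_mod_cast (show 0 < L by omega)
    positivity
  -- termwise facts
  have hterm : ∀ k : Tor L, k ≠ 0 →
      0 ≤ (1 - (phase L k r).re) / ((2 * epsT L k) * (2 * epsT L k - lam2)) ∧
        (1 - (phase L k r).re) / ((2 * epsT L k) * (2 * epsT L k - lam2))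
          ≤ min 2 ((kdotC L k r) ^ 2 / 2) / ((2 * epsT L k) ^ 2 * (1 - lam2 / (2 * epsT L k))) := by
    intro k hk
    have hε : eps1 L ≤ epsT L k := eps1_le_epsT L hL2 hk
    have ha : 0 < 2 * epsT L k := by linarith
    have hal : lam2 < 2 * epsT L k := by linarith
    rw [phaseReCentred_holds L k r]
    refine ⟨?_, termwise_shell _ _ _ ha hal⟩
    apply div_nonneg
    · linarith [Real.cos_le_one (kdotC L k r)]
    · have : 0 < 2 * epsT L k - lam2 := by linarith
      positivity
  constructor
  · apply div_nonneg _ hV.le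
    apply mul_nonneg h0
    refine Finset.sum_nonneg (fun k _ => ?_)
    split_ifs with hk
    · exact le_rfl
    · exact (hterm k hk).1
  · apply div_le_div_of_nonneg_right _ hV.le
    apply mul_le_mul_of_nonneg_left _ h0
    refine Finset.sum_le_sum (fun k _ => ?_)
    split_ifs with hk
    · exact le_rfl
    · exact (hterm k hk).2

end RateLemma

end Summit.HubbardSuperconductivity.HubbardSuperconductivity.Theorems.AnisotropyChord.Transfer.Fibre3

end
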